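import Mathlib
import Summits.ValiantsHypothesis.ValiantsHypothesis.Theses.ValuativeGCT
import Summits.ValiantsHypothesis.ValiantsHypothesis.Theorems.CutBites.Negative.NonVacuity

/-!
# `CutBites` — negative lemma, algebra part: LEFT MULTIPLICATIONS STABILISE `det_m`, AND
# LEFT-`SL_m`-INVARIANT FORMS OF DEGREE `mδ` ARE MULTIPLES OF `det_m ^ δ`

Crux `stmt-ValiantsHypothesis-12626` (`Theses.ValuativeGCT.CutBites`, route ValuativeGCT).  Standing
disprover (cdisprove gen 3), `Cruxes/CutBites/Disproof.lean` §I.2–§I.3, def-free so that planners /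
provers can import it; used by `OneRowWeightNeverCut` (§I.4: `T 0 = ℂ · det_m(last row)^δ` at the
one-row weight, never cut for odd `m`).

* `linSubst_leftMul_detFormLex` — the matrix of `X ↦ P X` (in the `linSubst` convention
  `X_i ↦ ∑_l M l i • X_l`, i.e. `M l i = [l₂ = i₂] P i₁ l₁`) fixes `det_m` when `det P = 1`
  (`det (P X) = det X`); with `eval_linSubst_leftMul` (it evaluates at `P · mat x`).
* `linSubst_eq_of_rename_rowAct_invariant` — if `rename (j, ·) q` is invariant under the crux's row
  action of `M`, then `q` is `linSubst M`-invariant (descent to one row).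
* `eq_C_mul_detFormLex_pow_of_leftSL_invariant` — a form `q` of degree `mδ` on `M_m` (`m ≥ 1`) with
  `q(P X) = q(X)` for all `P` of determinant `1` is `c · det_m ^ δ`: on the dense set `det X ≠ 0`,
  `X = P · diag(det X, 1, …, 1)` with `det P = 1`, so `q(X) = g(det X)` for the univariate restriction
  `g(u) = q(diag(u, 1, …, 1))`; `(q - g(det)) · det = 0` everywhere, hence `q = g(det)`
  (`MvPolynomial.funext`, domain); comparing homogeneous components leaves `g_δ · det^δ`.
[folklore]
-/

namespace Summit.ValiantsHypothesis.ValiantsHypothesis.Theorems.CutBites.Negative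

open Literature.NumberTheory.DiophantineGeometry Literature.Computability.AlgebraicComplexity
open MvPolynomial
open scoped BigOperators Matrix

noncomputable section

/-! ### Left multiplications `X ↦ P X` in the `linSubst` convention -/

/-- `linSubst` of the left-multiplication matrix on a variable: `X_(a,b) ↦ ∑_c P a c • X_(c,b)`.
[folklore] -/
theorem linSubst_leftMul_X {m : ℕ} (P : Matrix (Fin m) (Fin m) ℂ) (a b : Fin m) :
    linSubst (MatIdx m) ℂ (Matrix.of fun l i : MatIdx m =>
        if (ofLex l).2 = (ofLex i).2 then P (ofLex i).1 (ofLex l).1 else 0) (X (toLex (a, b)))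
      = ∑ c : Fin m, P a c • (X (toLex (c, b)) : MvPolynomial (MatIdx m) ℂ) := by
  rw [linSubst_X, ← Equiv.sum_comp (toLex : Fin m × Fin m ≃ MatIdx m), Fintype.sum_prod_type]
  refine Finset.sum_congr rfl fun c _ => ?_
  simp only [Matrix.of_apply, ofLex_toLex, ite_smul, zero_smul, Finset.sum_ite_eq',
    Finset.mem_univ, if_true]

/-- `det_m` in the lexicographic variables is the determinant of the generic matrix. [folklore] -/
theorem detFormLex_eq_det_of (m : ℕ) :
    detFormLex ℂ m = (Matrix.of fun a b : Fin m => (X (toLex (a, b)) : MvPolynomial (MatIdx m) ℂ)).det := by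
  rw [detFormLex, detPoly, AlgHom.map_det]
  congr 1
  ext a b
  simp [Matrix.mvPolynomialX, rename_X]

/-- The left-multiplication substitution maps the generic matrix to `P · X`. [folklore] -/
theorem mapMatrix_linSubst_leftMul {m : ℕ} (P : Matrix (Fin m) (Fin m) ℂ) :
    (linSubst (MatIdx m) ℂ (Matrix.of fun l i : MatIdx m =>
        if (ofLex l).2 = (ofLex i).2 then P (ofLex i).1 (ofLex l).1 else 0)).mapMatrix
        (Matrix.of fun a b : Fin m => (X (toLex (a, b)) : MvPolynomial (MatIdx m) ℂ))
      = P.map (C : ℂ →+* MvPolynomial (MatIdx m) ℂ)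
          * Matrix.of fun a b : Fin m => (X (toLex (a, b)) : MvPolynomial (MatIdx m) ℂ) := by
  ext a b
  rw [AlgHom.mapMatrix_apply, Matrix.map_apply, Matrix.of_apply, linSubst_leftMul_X, Matrix.mul_apply]
  simp [smul_eq_C_mul]

/-- **Left multiplications by `SL_m` stabilise `det_m`**: `det (P X) = det X` for `det P = 1`, i.e. the
left-multiplication matrix lies in the crux's `End`-stabiliser. [folklore] -/
theorem linSubst_leftMul_detFormLex {m : ℕ} (P : Matrix (Fin m) (Fin m) ℂ) (hP : P.det = 1) :
    linSubst (MatIdx m) ℂ (Matrix.of fun l i : MatIdx m =>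
        if (ofLex l).2 = (ofLex i).2 then P (ofLex i).1 (ofLex l).1 else 0) (detFormLex ℂ m)
      = detFormLex ℂ m := by
  rw [detFormLex_eq_det_of, AlgHom.map_det, mapMatrix_linSubst_leftMul, Matrix.det_mul,
    ← RingHom.mapMatrix_apply, ← RingHom.map_det, hP, map_one, one_mul]

/-- Evaluating `det_m` at a coordinate vector gives the determinant of the corresponding matrix.
[folklore] -/
theorem eval_detFormLex_eq_det (m : ℕ) (x : MatIdx m → ℂ) :
    MvPolynomial.eval x (detFormLex ℂ m) = (Matrix.of fun a b : Fin m => x (toLex (a, b))).det := by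
  rw [detFormLex_eq_det_of, RingHom.map_det]
  congr 1
  ext a b
  simp

/-- Evaluating `linSubst (leftMul P) q` at `x` evaluates `q` at `P · mat x`. [folklore] -/
theorem eval_linSubst_leftMul {m : ℕ} (P : Matrix (Fin m) (Fin m) ℂ) (q : MvPolynomial (MatIdx m) ℂ)
    (x : MatIdx m → ℂ) :
    MvPolynomial.eval x (linSubst (MatIdx m) ℂ (Matrix.of fun l i : MatIdx m =>
        if (ofLex l).2 = (ofLex i).2 then P (ofLex i).1 (ofLex l).1 else 0) q)
      = MvPolynomial.eval (fun i : MatIdx m =>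
          (P * Matrix.of fun a b : Fin m => x (toLex (a, b))) (ofLex i).1 (ofLex i).2) q := by
  set M : Matrix (MatIdx m) (MatIdx m) ℂ := Matrix.of fun l i : MatIdx m =>
    if (ofLex l).2 = (ofLex i).2 then P (ofLex i).1 (ofLex l).1 else 0 with hM
  have hcomp := AlgHom.congr_fun
    (MvPolynomial.comp_aeval (fun i : MatIdx m => ∑ j, M j i • (X j : MvPolynomial (MatIdx m) ℂ))
      (MvPolynomial.aeval (R := ℂ) x)) q
  rw [AlgHom.comp_apply] at hcomp
  have hpt : (fun i : MatIdx m => MvPolynomial.aeval (R := ℂ) x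
      (∑ j, M j i • (X j : MvPolynomial (MatIdx m) ℂ)))
      = fun i : MatIdx m => (P * Matrix.of fun a b : Fin m => x (toLex (a, b))) (ofLex i).1 (ofLex i).2 := by
    funext i
    have hli : (∑ j, M j i • (X j : MvPolynomial (MatIdx m) ℂ))
        = linSubst (MatIdx m) ℂ M (X (toLex ((ofLex i).1, (ofLex i).2))) := by
      rw [linSubst_X]; rfl
    rw [hli, hM, linSubst_leftMul_X, map_sum]
    simp only [map_smul, aeval_X, smul_eq_mul, Matrix.mul_apply, Matrix.of_apply]
  have h1 : MvPolynomial.eval x (linSubst (MatIdx m) ℂ M q)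
      = MvPolynomial.aeval (R := ℂ) x (linSubst (MatIdx m) ℂ M q) := rfl
  rw [h1, linSubst, hcomp, hpt]
  rfl

/-- **Descent to one row.**  If `rename (j, ·) q` is invariant under the crux's row action of `M`, then
`q` is `linSubst M`-invariant (`rename` along `i ↦ (j, i)` is injective). [folklore] -/
theorem linSubst_eq_of_rename_rowAct_invariant {m : ℕ} {q : MvPolynomial (MatIdx m) ℂ} {j : MatIdx m}
    {M : Matrix (MatIdx m) (MatIdx m) ℂ}
    (h : MvPolynomial.aeval (R := ℂ) (fun p : MatIdx m × MatIdx m =>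
        ∑ l : MatIdx m, M l p.2 • MvPolynomial.X (p.1, l)) (rename (fun i : MatIdx m => (j, i)) q)
      = rename (fun i : MatIdx m => (j, i)) q) :
    linSubst (MatIdx m) ℂ M q = q := by
  rw [aeval_rowAct_rename] at h
  exact rename_injective _ (Prod.mk_right_injective j) h

/-! ### Left-`SL_m`-invariant forms of degree `mδ` -/

/-- **`SL_m`-invariants of degree `mδ` are multiples of `det^δ`.**  A form `q` of degree `mδ` in the
`m × m` matrix variables (`m ≥ 1`) with `q(P X) = q(X)` for every `P` of determinant `1` (as the polynomial
identity `linSubst (leftMul P) q = q`) is `C c * det_m ^ δ` for some scalar `c`. [folklore] -/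
theorem eq_C_mul_detFormLex_pow_of_leftSL_invariant {m δ : ℕ} (hm : 0 < m)
    {q : MvPolynomial (MatIdx m) ℂ} (hqh : q.IsHomogeneous (m * δ))
    (hqinv : ∀ P : Matrix (Fin m) (Fin m) ℂ, P.det = 1 →
      linSubst (MatIdx m) ℂ (Matrix.of fun l i : MatIdx m =>
        if (ofLex l).2 = (ofLex i).2 then P (ofLex i).1 (ofLex l).1 else 0) q = q) :
    ∃ c : ℂ, q = C c * detFormLex ℂ m ^ δ := by
  set i₀ : Fin m := ⟨0, hm⟩ with hi₀
  -- `diag(d, 1, …, 1)`, its determinant, and the factorisation of a non-singular matrix through it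
  set D : ℂ → Matrix (Fin m) (Fin m) ℂ := fun d => Matrix.diagonal (Function.update (fun _ => (1 : ℂ)) i₀ d)
    with hD
  have hDdet : ∀ d, (D d).det = d := by
    intro d
    rw [hD]
    simp only [Matrix.det_diagonal]
    rw [Finset.prod_update_of_mem (Finset.mem_univ _)]
    simp
  -- the univariate restriction `g(u) = q(diag(u, 1, …, 1))`
  set f : MatIdx m → Polynomial ℂ := fun i =>
    if (ofLex i).1 = (ofLex i).2 then (if (ofLex i).1 = i₀ then Polynomial.X else 1) else 0 with hf
  set g : Polynomial ℂ := MvPolynomial.aeval (R := ℂ) f q with hg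
  have hgeval : ∀ d : ℂ, g.eval d = MvPolynomial.eval (fun i : MatIdx m => D d (ofLex i).1 (ofLex i).2) q := by
    intro d
    rw [hg, ← Polynomial.coe_aeval_eq_eval]
    have hcomp := AlgHom.congr_fun (MvPolynomial.comp_aeval (R := ℂ) f (Polynomial.aeval (R := ℂ) d)) q
    rw [AlgHom.comp_apply] at hcomp
    rw [hcomp]
    have hpt : (fun i : MatIdx m => Polynomial.aeval (R := ℂ) d (f i))
        = fun i : MatIdx m => D d (ofLex i).1 (ofLex i).2 := by
      funext i
      simp only [hf, hD, Matrix.diagonal_apply, Function.update_apply]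
      split_ifs with h1 h2 <;> simp_all
    rw [hpt]
    rfl
  -- (a) on `det X ≠ 0`, `q(X) = g(det X)`
  have ha : ∀ x : MatIdx m → ℂ, (Matrix.of fun a b : Fin m => x (toLex (a, b))).det ≠ 0 →
      MvPolynomial.eval x q = g.eval (Matrix.of fun a b : Fin m => x (toLex (a, b))).det := by
    intro x hx
    set X : Matrix (Fin m) (Fin m) ℂ := Matrix.of fun a b : Fin m => x (toLex (a, b)) with hX
    set d := X.det
    have hDunit : IsUnit (D d).det := by rw [hDdet]; exact isUnit_iff_ne_zero.mpr hx
    set P := X * (D d)⁻¹ with hP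
    have hPdet : P.det = 1 := by
      rw [hP, Matrix.det_mul, Matrix.det_nonsing_inv, hDdet, Ring.inverse_eq_inv, mul_inv_cancel₀ hx]
    have hPD : P * D d = X := Matrix.nonsing_inv_mul_cancel_right _ _ hDunit
    have h := congrArg (MvPolynomial.eval (fun i : MatIdx m => D d (ofLex i).1 (ofLex i).2)) (hqinv P hPdet)
    rw [eval_linSubst_leftMul] at h
    have hmat : (Matrix.of fun a b : Fin m => (fun i : MatIdx m => D d (ofLex i).1 (ofLex i).2) (toLex (a, b)))
        = D d := by
      ext a b; simp
    rw [hmat, hPD] at h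
    have hvec : (fun i : MatIdx m => X (ofLex i).1 (ofLex i).2) = x := by
      funext i; simp [hX]
    rw [hvec] at h
    rw [h, hgeval]
  -- (b) hence `(q - g(det)) · det = 0`, so `q = g(det)`
  have hb : q = Polynomial.aeval (detFormLex ℂ m) g := by
    have hzero : (q - Polynomial.aeval (detFormLex ℂ m) g) * detFormLex ℂ m = 0 := by
      refine MvPolynomial.funext fun x => ?_
      rw [map_mul, map_zero, eval_detFormLex_eq_det]
      by_cases hx : (Matrix.of fun a b : Fin m => x (toLex (a, b))).det = 0
      · rw [hx, mul_zero]
      · rw [map_sub, ha x hx]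
        have : MvPolynomial.eval x (Polynomial.aeval (detFormLex ℂ m) g)
            = g.eval (Matrix.of fun a b : Fin m => x (toLex (a, b))).det := by
          have h := Polynomial.aeval_algHom_apply (MvPolynomial.aeval (R := ℂ) x) (detFormLex ℂ m) g
          rw [Polynomial.coe_aeval_eq_eval] at h
          change MvPolynomial.aeval (R := ℂ) x (Polynomial.aeval (detFormLex ℂ m) g) = _
          rw [← h]
          congr 1
          exact eval_detFormLex_eq_det m x
        rw [this, sub_self, zero_mul]
    rcases mul_eq_zero.mp hzero with h | h
    · exact sub_eq_zero.mp h
    · exact absurd h (detFormLex_ne_zero' m)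
  -- (c) homogeneous components: only `det^δ` survives
  refine ⟨g.coeff δ, ?_⟩
  have hcomp := congrArg (MvPolynomial.homogeneousComponent (m * δ)) hb
  rw [homogeneousComponent_of_mem ((mem_homogeneousSubmodule _ _).mpr hqh), if_pos rfl] at hcomp
  rw [hcomp, Polynomial.aeval_eq_sum_range, map_sum]
  have hk : ∀ k : ℕ, MvPolynomial.homogeneousComponent (m * δ) (g.coeff k • detFormLex ℂ m ^ k)
      = if k = δ then C (g.coeff δ) * detFormLex ℂ m ^ δ else 0 := by
    intro k
    rw [map_smul, homogeneousComponent_of_mem ((mem_homogeneousSubmodule _ _).mpr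
      ((detFormLex_isHomogeneous ℂ m).pow k))]
    by_cases hkδ : k = δ
    · subst hkδ; rw [if_pos rfl, if_pos rfl, smul_eq_C_mul]
    · rw [if_neg hkδ, if_neg (fun h => hkδ (Nat.eq_of_mul_eq_mul_left hm h).symm), smul_zero]
  simp only [hk, Finset.sum_ite_eq', Finset.mem_range]
  by_cases hδ : δ < g.natDegree + 1
  · rw [if_pos hδ]
  · rw [if_neg hδ, Polynomial.coeff_eq_zero_of_natDegree_lt (by omega), map_zero, zero_mul]

end

end Summit.ValiantsHypothesis.ValiantsHypothesis.Theorems.CutBites.Negative
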